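import Summits.MatrixMultiplication.OmegaCensus.ThreeSetZ5Z5CoverKitC
import HarnessLib

/-!
# The two-margin kernel enumerator on `ZMod p × ZMod p` WITH AN EXCEPTION LIST

ω-census `pub-omega`, family (b3), seat pub-omega-group gen 37.  Framing: lottery ticket; floor = certified bounds/negative
ranges.  VALUE: kernel infrastructure for the `ℤ₅²`-stage of the cells `(3,3,12)@325`, `(3,4,9)@325` of `ℤ₅ × ℤ₆₅`
(`ThreeSetZ5Z65Cells3x.lean`), where a handful of count vectors have NO certified line direction and must be named and treated
at the plane / `ℤ₁₃` level; NOT progress on ω.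

`ThreeSetZ5Z5CoverKitC.cover3C p d tree` (gen 36) certifies that EVERY count vector `g` (a multiset of size `d` on `ZMod p × ZMod p`)
reaches an unflagged tagged line code.  Here the leaves of the same column-capacity row enumeration may ALSO pass when the full
matrix of `g` (its list of rows, `ZpZpDomino.rowsOf g`) is one of an explicit list `exc` of exceptions:
* `rowsEnumE` / `rowsEnumE_spec` — the row enumerator carrying the rows placed so far; `coverGenE` / `coverGenE_spec`;
* `cover3E p d tree exc` and **`exists_unflagged_or_exc_of_cover3E`**, **`exists_cert_or_exc_of_cover3E`** — every `g` with
  `Σ g = d` has a direction `j ≤ p` with `cert j (cnts p j g)` (given `soundChk3`), OR `rowsOf g ∈ exc`;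
* `apply_cell_of_rowsOf_eq` — reading `g` back from `rowsOf g`.
Nothing about `tree` or `exc` is trusted: the conclusion names the exception explicitly.
-/

namespace Summit.MatrixMultiplication.OmegaCensus

open Finset

namespace ZpZpDomino

/-! ## The row enumerator with exceptions -/

/-- Rows with prescribed sums `R` drawn from the compositions bounded by the remaining column capacities, carrying the rows
placed so far (`pre`); a leaf passes if some accumulated code is NOT flagged by `tree` OR the matrix is listed in `exc`.
[folklore] -/
def rowsEnumE (tree : BTree) (exc : List (List (List ℕ))) :
    List (List (List ℕ)) → List ℕ → List ℕ → List ℕ → List (List ℕ) → Bool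
  | w :: ws, r :: R, cap, accs, pre =>
      (compsUB cap r).all fun row => rowsEnumE tree exc ws R (subCap cap row) (addRow w accs row) (pre ++ [row])
  | _, _, _, accs, pre => (accs.any fun a => !(tree.mem a)) || exc.any fun e => e == pre

/-- **Specification of the row enumerator with exceptions**: every matrix with row sums `R`, rows of length `cap.length` and
column sums bounded by `cap` reaches a leaf where some accumulated code is unflagged or `pre ++ M` is an exception. [folklore] -/
theorem rowsEnumE_spec (tree : BTree) (exc : List (List (List ℕ))) : ∀ (ws : List (List (List ℕ))) (R cap accs : List ℕ)
    (pre : List (List ℕ)),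
    rowsEnumE tree exc ws R cap accs pre = true → ws.length = R.length →
    ∀ M : List (List ℕ), M.length = R.length →
    (∀ t < R.length, (M.getD t []).length = cap.length ∧ (M.getD t []).sum = R.getD t 0) →
    (∀ k < cap.length, (∑ t ∈ range R.length, (M.getD t []).getD k 0) ≤ cap.getD k 0) →
    ((accsAfter ws accs M).any (fun a => !(tree.mem a)) || exc.any fun e => e == pre ++ M) = true
  | [], [], cap, accs, pre, h, _, M, hM, _, _ => by
    have hM' : M = [] := List.eq_nil_of_length_eq_zero hM
    subst hM'
    simpa [rowsEnumE, accsAfter] using h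
  | [], _ :: _, _, _, _, _, hl, _, _, _, _ => by simp at hl
  | _ :: _, [], _, _, _, _, hl, _, _, _, _ => by simp at hl
  | w :: ws, r :: R, cap, accs, pre, h, hl, M, hM, hrows, hcols => by
    obtain ⟨row, M', rfl⟩ := List.exists_cons_of_length_eq_add_one hM
    simp only [rowsEnumE, List.all_eq_true] at h
    simp only [List.length_cons, Nat.add_right_cancel_iff] at hl hM
    have h0 := hrows 0 (by simp)
    simp only [List.getD_cons_zero] at h0
    have hrowcap : ∀ k < cap.length, row.getD k 0 ≤ cap.getD k 0 := fun k hk => by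
      have hc := hcols k hk
      rw [List.length_cons, sum_range_succ'] at hc
      simp only [List.getD_cons_zero, List.getD_cons_succ] at hc
      omega
    have hmem : row ∈ compsUB cap r := mem_compsUB cap r row h0.1 h0.2 hrowcap
    simp only [accsAfter]
    have happ : pre ++ row :: M' = (pre ++ [row]) ++ M' := by simp
    rw [happ]
    refine rowsEnumE_spec tree exc ws R (subCap cap row) _ _ (h row hmem) hl M' hM (fun t ht => ?_) (fun k hk => ?_)
    · have h1 := hrows (t + 1) (by simpa using ht)
      simp only [List.getD_cons_succ] at h1
      rw [length_subCap _ _ h0.1]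
      exact h1
    · rw [length_subCap _ _ h0.1] at hk
      rw [getD_subCap _ _ h0.1 hk]
      have hc := hcols k hk
      rw [List.length_cons, sum_range_succ'] at hc
      simp only [List.getD_cons_zero, List.getD_cons_succ] at hc
      omega

/-- **The two-margin cover program with exceptions.** [folklore] -/
def coverGenE (tree : BTree) (exc : List (List (List ℕ))) (B : ℕ) (ws : List (List (List ℕ))) (Rlist Clist : List (List ℕ))
    (init : List ℕ) (offC : ℕ) : Bool :=
  Rlist.all fun R => !(tree.mem (polyBE B R)) ||
    Clist.all fun C => !(tree.mem (offC + polyBE B C)) || rowsEnumE tree exc ws R C init []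

/-- **Specification of the two-margin cover program with exceptions.** [folklore] -/
theorem coverGenE_spec {tree : BTree} {exc : List (List (List ℕ))} {B : ℕ} {ws : List (List (List ℕ))}
    {Rlist Clist : List (List ℕ)} {init : List ℕ} {offC : ℕ} (h : coverGenE tree exc B ws Rlist Clist init offC = true)
    (R : List ℕ) (hR : R ∈ Rlist) (hRl : ws.length = R.length) (C : List ℕ) (hC : C ∈ Clist) :
    tree.mem (polyBE B R) = false ∨ tree.mem (offC + polyBE B C) = false ∨
      ∀ M : List (List ℕ), M.length = R.length →
        (∀ t < R.length, (M.getD t []).length = C.length ∧ (M.getD t []).sum = R.getD t 0) →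
        (∀ k < C.length, (∑ t ∈ range R.length, (M.getD t []).getD k 0) ≤ C.getD k 0) →
        ((accsAfter ws init M).any (fun a => !(tree.mem a)) || exc.any fun e => e == M) = true := by
  simp only [coverGenE, List.all_eq_true] at h
  have hR' := h R hR
  rcases Bool.or_eq_true_iff.1 hR' with h1 | h2
  · left; simpa using h1
  · rw [List.all_eq_true] at h2
    rcases Bool.or_eq_true_iff.1 (h2 C hC) with h3 | h4
    · right; left; simpa using h3
    · right; right
      intro M hM hrows hcols
      have := rowsEnumE_spec tree exc ws R C init [] h4 hRl M hM hrows hcols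
      simpa using this

/-- **The two-margin three-set cover program with exceptions** (row sums direction `0`, column sums direction `1`). [folklore] -/
def cover3E (p d : ℕ) (tree : BTree) (exc : List (List (List ℕ))) : Bool :=
  coverGenE tree exc (d + 1) (rowWs p (d + 1)) (compsLB [] p d) (compsLB [] p d) (offs p (d + 1)) (off p (d + 1) 1)

/-! ## Semantics -/

section Semantic

variable {p : ℕ} [NeZero p]

/-- **From the cover program with exceptions to an unflagged tagged code or a listed exception.** [folklore] -/
theorem exists_unflagged_or_exc_of_cover3E {d : ℕ} (tree : BTree) (exc : List (List (List ℕ)))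
    (h : cover3E p d tree exc = true) (g : Fin (p * p) → ℕ) (hg : ∑ i, g i = d) :
    (∃ j < p + 1, tree.mem (off p (d + 1) j + polyBE (d + 1) (cnts p j g)) = false) ∨ rowsOf g ∈ exc := by
  have hp0 : 0 < p := Nat.pos_of_ne_zero (NeZero.ne p)
  have hRlen : (rowSums g).length = p := length_rowSums g
  have hRsum : (rowSums g).sum = d := by rw [sum_rowSums, hg]
  have hRmem : rowSums g ∈ compsLB [] p d := mem_compsLB [] p d _ hRlen hRsum fun k _ => by simp
  have hCmem : cnts p 1 g ∈ compsLB [] p d := hg ▸ cnts_mem_compsLB 1 g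
  rcases coverGenE_spec h _ hRmem (by rw [length_rowWs, hRlen]) _ hCmem with hR | hC | hM
  · exact Or.inl ⟨0, by omega, by rw [cnts_zero_eq_rowSums, off_zero, zero_add]; exact hR⟩
  · exact Or.inl ⟨1, by omega, hC⟩
  · have hrows : ∀ t < (rowSums g).length,
        ((rowsOf g).getD t []).length = (cnts p 1 g).length ∧ ((rowsOf g).getD t []).sum = (rowSums g).getD t 0 := by
      intro t ht
      rw [hRlen] at ht
      rw [getD_rowsOf g ht, length_cnts, List.length_ofFn, List.sum_ofFn, getD_rowSums g ht]
      exact ⟨rfl, rfl⟩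
    have hcols : ∀ k < (cnts p 1 g).length,
        (∑ t ∈ range (rowSums g).length, ((rowsOf g).getD t []).getD k 0) ≤ (cnts p 1 g).getD k 0 := by
      intro k hk
      rw [length_cnts] at hk
      rw [hRlen, getD_cnts 1 g hk, sum_range, sum_pick_one g ⟨k, hk⟩]
      refine le_of_eq (Fintype.sum_congr _ _ fun t => ?_)
      rw [getD_rowsOf g t.isLt, Literature.Computability.Complexity.getD_ofFn _ _ hk]
    have hany := hM (rowsOf g) (by rw [length_rowsOf, hRlen]) hrows hcols
    rcases Bool.or_eq_true_iff.1 hany with hany | hexc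
    · left
      rw [List.any_eq_true] at hany
      obtain ⟨a, ha, hfa⟩ := hany
      obtain ⟨j, hj, rfl⟩ := List.getElem_of_mem ha
      have hws : ∀ w ∈ rowWs p (d + 1), ∀ x ∈ w, x.length = (offs p (d + 1)).length := by
        intro w hw x hx
        simp only [rowWs, List.mem_map, List.mem_range] at hw
        obtain ⟨t, -, rfl⟩ := hw
        simp only [rowW, List.mem_map, List.mem_range] at hx
        obtain ⟨u, -, rfl⟩ := hx
        simp
      have hlen : (accsAfter (rowWs p (d + 1)) (offs p (d + 1)) (rowsOf g)).length = p + 1 := by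
        rw [length_accsAfter _ _ _ hws, length_offs]
      have hj' : j < p + 1 := by rw [← hlen]; exact hj
      refine ⟨j, hj', ?_⟩
      have e := getD_accsAfter_rowsOf_init (d + 1) g (offs p (d + 1)) (length_offs _ _) hj'
      rw [List.getD_eq_getElem _ _ hj, getD_offs _ _ hj', code_eq_polyBE] at e
      rw [← e]
      simpa using hfa
    · right
      rw [List.any_eq_true] at hexc
      obtain ⟨e, he, hee⟩ := hexc
      rw [beq_iff_eq] at hee
      rw [← hee]; exact he

/-- **From the cover program with exceptions and the soundness check to a certified direction or a listed exception.**
[folklore] -/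
theorem exists_cert_or_exc_of_cover3E {d : ℕ} (tree : BTree) (exc : List (List (List ℕ))) (cert : ℕ → List ℕ → Bool)
    (hs : soundChk3 p d tree cert = true) (h : cover3E p d tree exc = true)
    (g : Fin (p * p) → ℕ) (hg : ∑ i, g i = d) :
    (∃ j < p + 1, cert j (cnts p j g) = true) ∨ rowsOf g ∈ exc := by
  rcases exists_unflagged_or_exc_of_cover3E tree exc h g hg with ⟨j, hj, hmem⟩ | hexc
  · left
    refine ⟨j, hj, ?_⟩
    simp only [soundChk3, List.all_eq_true, List.mem_range] at hs
    have h1 := hs j hj (cnts p j g) (hg ▸ cnts_mem_compsLB j g)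
    rw [hmem, Bool.false_or] at h1
    exact h1
  · exact Or.inr hexc

omit [NeZero p] in
/-- **Reading `g` back from its rows**: if `rowsOf g = e` then `g (cell t u) = e[t][u]`. [folklore] -/
theorem apply_cell_of_rowsOf_eq {g : Fin (p * p) → ℕ} {e : List (List ℕ)} (h : rowsOf g = e) (t u : Fin p) :
    g (cell t u) = (e.getD t.val []).getD u.val 0 := by
  rw [← h, getD_rowsOf g t.isLt, List.getD_eq_getElem _ _ (by simp), List.getElem_ofFn]

end Semantic

end ZpZpDomino

end Summit.MatrixMultiplication.OmegaCensus
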